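import Mathlib
import HarnessLib
import Summits.AtomisticToContinuum.HydrodynamicLimit.Theses.CollisionIsometryCLT
import Literature.Analysis.FluidPDE.HardSphereFlowConstruction
import Literature.Analysis.FluidPDE.CollisionalTransfer

/-!
# Sketch — first lemmas of three crux ideas for `CollisionalTransferLocality` (stmt-9518)

crux-ideate round 1, ideator 2. Each `def … : Prop` below is the "First lemma" of one idea card;
they are statements only (no proofs), over existing declarations.
-/

set_option autoImplicit false

namespace Summit.AtomisticToContinuum.HydrodynamicLimit.Cruxes.CollisionalTransferLocality.Sketch

open scoped BigOperators Topology InnerProductSpace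
open Filter Set MeasureTheory

/-- **Card `contact-chaos-by-row-orthogonality`, first lemma (provable now).**
Row orthonormality `M Mᵀ = I` (blockwise, INCLUDING the vanishing of the cross blocks `i ≠ j`)
of the frozen-geometry velocity transfer `M` of route CollisionIsometryCLT (same `let M` text as
`TransferIsometry`, stmt-12951): for distinct particles `i ≠ j` the transfer rows are orthogonal
3 × 3(N+1) matrices, so conditionally on the collision forest the pre-collisional pair
`(vᵢ, vⱼ)` has ZERO cross-covariance whenever the ancestors have a common isotropic covariance —
the algebraic core of one-sided molecular chaos at contact. Finite-dimensional linear algebra: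
`M` is a linear isometry of `ℝ^{3(N+1)}` (TransferIsometry), hence orthogonal, hence `M Mᵀ = I`. -/
def RowOrthonormality : Prop :=
  ∀ (σ : ℝ), let M := fun (N : ℕ) (y : Literature.Analysis.FluidPDE.Config (N + 1) (Fin 3) (UnitAddTorus (Fin 3))) (Δ : ℝ) (W : Fin (N + 1) → EuclideanSpace ℝ (Fin 3)) => (let G := Literature.Analysis.FluidPDE.Torus.geometry (Fin 3); let ε : ℝ := Literature.MathematicalPhysics.KineticTheory.hsDiameter σ N; let pre := fun k : ℕ => (let zk := Literature.Analysis.FluidPDE.Alexander.stateAfter G ε y k; Literature.Analysis.FluidPDE.freeFlight G (Literature.Analysis.FluidPDE.Alexander.freeExitTime G ε zk).toReal zk); (List.range (Literature.Analysis.FluidPDE.Alexander.collisionCount G ε y Δ)).foldl (fun W' k => @dite (Fin (N + 1) → EuclideanSpace ℝ (Fin 3)) (Literature.Analysis.FluidPDE.Alexander.incomingPairs G ε (pre k)).Nonempty (Classical.propDecidable _) (fun h => fun i => (Literature.Analysis.FluidPDE.collidePair G h.some.1 h.some.2 (fun j => ((pre k j).1, W' j)) i).2) (fun _ => W')) W)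;
  ∀ (N : ℕ) (y : Literature.Analysis.FluidPDE.Config (N + 1) (Fin 3) (UnitAddTorus (Fin 3))) (Δ : ℝ)
    (i j : Fin (N + 1)) (a' b' : Fin 3),
    (∑ k : Fin (N + 1), ∑ a : Fin 3,
        (M N y Δ (Pi.single k (EuclideanSpace.single a (1 : ℝ))) i) a' *
        (M N y Δ (Pi.single k (EuclideanSpace.single a (1 : ℝ))) j) b')
      = if i = j ∧ a' = b' then 1 else 0

/-- The pair-shell observable of the clock Ward identity (card `ward-bgy-contact-rigidity`):
`A_F(z) = (N+1)⁻¹ Σ_{i ≠ j} F(d_ij/ε) ⟨vᵢ − vⱼ, r⃗_ij⟩` with `r⃗_ij` the torus separation vector and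
`d_ij = ‖r⃗_ij‖`; `F` smooth, `F = 1` on `[1, 1+δ]`, decreasing to `0` at `1 + 2δ`. Along free flight
`d/dt A_F = (N+1)⁻¹ Σ [F'(d/ε)(g·r̂)²(d/ε) + F(d/ε)|g|²]`; at an `(i,j)` collision `A_F` jumps by
`4 F(1) ε |g·ω| /(N+1)` (the CLOCK), at a third-party collision by `O(ε|Δv|/(N+1))`. -/
noncomputable def pairShellObsT (N : ℕ) (ε : ℝ) (F : ℝ → ℝ)
    (z : Literature.Analysis.FluidPDE.Config (N + 1) (Fin 3) (UnitAddTorus (Fin 3))) : ℝ :=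
  ((N + 1 : ℕ) : ℝ)⁻¹ * ∑ i : Fin (N + 1), ∑ j : Fin (N + 1),
    if i = j then 0 else
      F (Literature.Analysis.FluidPDE.Torus.euclidDist (z i).1 (z j).1 / ε) *
        ⟪(z i).2 - (z j).2, (Literature.Analysis.FluidPDE.Torus.geometry (Fin 3)).sepVec (z i).1 (z j).1⟫_ℝ

/-- **Card `ward-bgy-contact-rigidity`, first lemma (provable now): the collision jump of the
pair-shell observable = clock + third-party terms.** The tree already has the weak balance law
`Literature.Analysis.FluidPDE.HardSphereFlow.sub_eq_integral_add_collisionalTransfer` (residual of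
the crux's shape = `collisionalTransfer` = finite sum of `collisionJump`s; used in the crux's
Disproof.lean §1) and the jumps of the momentum/energy observables
(`collisionJump_momentumObservable`, `collisionJump_energyObservable`). NEW here: for the pair-shell
observable `pairShellObs` (below) at a binary collision of `{i, j}` on a hard-sphere trajectory,
the jump is `(N+1)⁻¹ [4 F(1) ε ‖Δvᵢ‖ + 2 Σ_{k ≠ i,j} (F(d_ik/ε)⟨Δvᵢ, r⃗_ik⟩ − F(d_jk/ε)⟨Δvᵢ, r⃗_jk⟩)]`,
`Δvᵢ = vᵢ⁺ − vᵢ⁻` (positions and the other velocities do not jump; `Δvⱼ = −Δvᵢ`; `Δvᵢ` is along the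
contact vector `r⃗_ij`, of length `ε`, pointing away from `j`, `inner_reflectVel_fst_sub_snd`) — the
first term is the CLOCK `ε|g·ω|`, the second the third-party production of the Ward identity. -/
def CollisionJumpPairShell : Prop :=
  ∀ (σ : ℝ) (N : ℕ), 0 < σ →
    let G := Literature.Analysis.FluidPDE.Torus.geometry (Fin 3)
    let ε : ℝ := Literature.MathematicalPhysics.KineticTheory.hsDiameter σ N
    ∀ (F : ℝ → ℝ) (γ : ℝ → Literature.Analysis.FluidPDE.Config (N + 1) (Fin 3) (UnitAddTorus (Fin 3))),
      Literature.Analysis.FluidPDE.IsHardSphereTrajectory G ε (N + 1) γ →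
      ∀ (t : ℝ) (i j : Fin (N + 1)), i ≠ j →
        γ t ∈ Literature.Analysis.FluidPDE.contactSet G (N + 1) ε i j →
        let Δv : EuclideanSpace ℝ (Fin 3) := (γ t i).2 - (Function.leftLim γ t i).2
        Literature.Analysis.FluidPDE.collisionJump (pairShellObsT N ε F) γ t =
          ((N + 1 : ℕ) : ℝ)⁻¹ *
            (4 * F 1 * ε * ‖Δv‖ +
              2 * ∑ k : Fin (N + 1), if k = i ∨ k = j then 0 else
                (F (Literature.Analysis.FluidPDE.Torus.euclidDist (γ t i).1 (γ t k).1 / ε) *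
                    ⟪Δv, G.sepVec (γ t i).1 (γ t k).1⟫_ℝ -
                  F (Literature.Analysis.FluidPDE.Torus.euclidDist (γ t j).1 (γ t k).1 / ε) *
                    ⟪Δv, G.sepVec (γ t j).1 (γ t k).1⟫_ℝ))

/-- **Card `activity-pricing-l2-transfer`, first lemma (provable now): the time-uniform L²
transfer.** With `LG` the local Gibbs law and `G` the constant-profile (global canonical Gibbs)
law, if `LG ≪ G` and `G` is invariant under the flow, then for every measurable event `A` and
EVERY time `t`: `LG(Φ_t ∈ A) ≤ ‖dLG/dG‖_{L²(G)} · G(A)^{1/2}` (Cauchy–Schwarz + invariance), with a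
constant that does not depend on `t` (finite iff `θc > max θ₀ / 2`; the square-integrability is a hypothesis) — so any event of `G`-cost beyond `2·log‖dLG/dG‖₂ = O(N)`
(e.g. a super-extensively priced sustained contact-statistics defect) is negligible at all times. -/
def L2Transfer : Prop :=
  ∀ (σ θc : ℝ) (a₀ θ₀ : UnitAddTorus (Fin 3) → ℝ) (u₀ : UnitAddTorus (Fin 3) → EuclideanSpace ℝ (Fin 3))
    (N : ℕ) (Φ : Literature.Analysis.FluidPDE.HardSphereFlow
      (Literature.Analysis.FluidPDE.Torus.geometry (Fin 3))
      (Literature.MathematicalPhysics.KineticTheory.hsDiameter σ N) (N + 1)),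
    let LG := Literature.MathematicalPhysics.KineticTheory.localGibbsLaw σ a₀ u₀ θ₀ N Φ
    let Gc := Literature.MathematicalPhysics.KineticTheory.localGibbsLaw σ (fun _ => 1) (fun _ => 0)
      (fun _ => θc) N Φ
    LG ≪ Gc → (∀ t : ℝ, Measure.map (Φ.flow t) Gc = Gc) →
      Integrable (fun z => (LG.rnDeriv Gc z).toReal ^ 2) Gc →
      ∀ (A : Set (Literature.Analysis.FluidPDE.Config (N + 1) (Fin 3) (UnitAddTorus (Fin 3)))) (t : ℝ),
        MeasurableSet A →
        (LG ((Φ.flow t) ⁻¹' A)).toReal ≤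
          (∫ z, (LG.rnDeriv Gc z).toReal ^ 2 ∂Gc) ^ (1 / 2 : ℝ) * (Gc A).toReal ^ (1 / 2 : ℝ)

end Summit.AtomisticToContinuum.HydrodynamicLimit.Cruxes.CollisionalTransferLocality.Sketch
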